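import Literature.NumberTheory.EllipticCurves.Kim2025.FineOneSidedDivisibility
import HarnessLib

/-!
# C.-H. Kim, arXiv:2505.09121v1, Thm. 3.19 for an elliptic curve, IN ITS PRINTED (FINE) CURRENCY:
# the fine main identity `length(𝐇¹_Γ/Z)_𝔭 = length(X₀)_𝔭` at every height-one prime `𝔭 ∌ p`,
# FROM the tree's refereed Mazur-form main theorems (Burungale–Castella–Skinner 2025 Thm. 1.1.2 (a);
# Skinner–Urban 2014 Thm. 3.6.9) over Kato's §17.13 package — theorems only

Topic `NumberTheory/EllipticCurves`, sub-directory `Kim2025`; namespace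
`Literature.NumberTheory.EllipticCurves.Kim2025`.  Typing layer (cell `bsd-littype`, seat 09, gen 4);
third of the fine-currency companions (`MainIdentityAtAugmentationFineDictionary`: the prime `(T)`;
`FineOneSidedDivisibility`: Thm. 3.18 (1)).  HONEST FRAMING: THEOREMS ONLY (0 definitions, 0 named
facts); every research input is one of the tree's NAMED facts passed as an explicit hypothesis
(`burungale_castella_skinner_charIdeal_eq_padicLFunction`, `skinner_urban_main_conjecture`,
`Kato2004.exists_divisibilityInputs_fineQuotient`) or a field of Kato's package; nothing is booked;
BSD is not advanced.

The printed statement (held text `paper:arxiv-2505.09121`, §3.5.3, chunk p0014:L75–L81):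

> **Theorem 3.19 (Kato, Skinner–Urban, Wan).** Suppose that `ψ = 𝟙` and `f` is good ordinary at `p`
> and `p`-distinguished.  (SU) If `ρ_f` has large image, `k ≡ 2 (mod p − 1)`, and there exists a prime
> `ℓ` exactly dividing `N` where `ρ̄_f` is ramified, then
> `ord_𝔓(char_Λ(H¹_Iw(ℚ, T_f(k−1))/Λκ^{Kato,k−1,∞}_1)) = ord_𝔓(char_Λ(Sel₀(ℚ_∞, W_f(1))^∨))` for
> every height one prime `𝔓` of `Λ`.  (Wan) If `p ≥ 5` and `ρ̄_f` is irreducible, then [the same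
> identity] for every height one prime `𝔓` except `πΛ`.  *Proof.* See [kato-euler-systems],
> [skinner-urban], and [wan_hilbert].  The latter two results concern the Iwasawa main conjecture
> with `p`-adic `L`-functions, which is equivalent to Conjecture 3.17 via the global Poitou–Tate
> duality [kato-euler-systems].

For an ELLIPTIC CURVE (`k = 2`, `T_f(1) ≅ T_pE`, `𝔓 ↔` a height-one prime `𝔭` of `Λ = ℤ_p⟦T⟧`,
`πΛ ↔ (p)`), this file PROVES the "equivalent via Poitou–Tate" step at EVERY height-one `𝔭 ∌ p` over
the §17.13 package and composes it with the tree's Mazur-form facts: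

* `lengthAt_quotient_span_eq_of_eq_C_zpow_mul` — `ℓ_𝔭(Λ/(g)) = ℓ_𝔭(Λ/(G₁))` at `𝔭 ∌ p` whenever
  `ι g = p^k · ι G₁` in `ℚ_p⟦T⟧` (`k ∈ ℤ`): powers of `p` are invisible off `(p)`;
* `lengthAt_add_lengthAt_quotient_zeta_eq_offP`, `fine_iff_mazur_offP` — Kato's p. 280 identity at a
  height-one `𝔭 ∌ p` with the fine quotient in place of `𝐇²`, and the resulting equivalence
  `ℓ_𝔭(𝐇¹_Γ/Z) = ℓ_𝔭(Y) ↔ ℓ_𝔭(X(E/ℚ_∞)) = ℓ_𝔭(Λ/(G₁))` (`ι G₁ = L_p(E,T)`);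
* `fine_offP_of_charIdeal_eq_span` — the RATIONAL Mazur-form identity `char_Λ X = (g)`,
  `ι g = p^k L_p` gives the fine identity at every height-one `𝔭 ∌ p`;
* `fine_offP_of_bcs` (**the (Wan)-slot for `E`, via BCS 2025 Thm. 1.1.2 (a): `p ≥ 5` good ordinary,
  `E[p]` irreducible — "every height one prime except `πΛ`", EXACTLY the printed exception**) and
  `fine_offP_of_skinnerUrban` (the (SU) clause, `p ≥ 3`, weaker than print: `𝔭 = (p)` not derived
  here), both over a package with fine quotient; `exists_fine_offP_of_bcs_of_fineQuotient` — the
  instance on `WeierstrassCurve.FineSelmerDualData` consuming `exists_divisibilityInputs_fineQuotient`.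

READING of the package's `Z` as Kim's `Λκ^{Kato,∞}_1` and scope (good ordinary `p`): as in the two
companion files.  The non-ordinary form of Thm. 1.2 / 3.17 has no tree carrier (OPEN-QUESTIONS-09 Q12).

## References
* C.-H. Kim (app. with R. Pollack), arXiv:2505.09121v1 (2025), Thm. 3.19 and its proof, statement
  3.17 (§3.5.3). [Kim2025RefinedTNC]
* K. Kato, Astérisque 295 (2004), Thm. 12.5 (pp. 221–222), Thm. 16.6 (p. 271), Prop. 17.11 (p. 277),
  §17.13 (pp. 279–280). [Kato2004Asterisque]
* A. Burungale, F. Castella, C. Skinner, IMRN 2025 (arXiv:2405.00270v2), Thm. 1.1.2 (a). [BurungaleCastellaSkinner2025]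
* C. Skinner, E. Urban, Invent. Math. 195 (2014), Thm. 3.6.9. [SkinnerUrban2014]
* B. Mazur, J. Tate, J. Teitelbaum, Invent. Math. 84 (1986), §I.12 (`Λ ⊗ ℚ_p`). [MazurTateTeitelbaum1986Invent]
-/

noncomputable section

open scoped MatrixGroups ModularForm Classical

open CongruenceSubgroup Literature.NumberTheory.EllipticCurves.ModularForms
  Literature.NumberTheory.EllipticCurves Literature.NumberTheory.EllipticCurves.Module
  Literature.NumberTheory.EllipticCurves.IwasawaAlgebra
open Field Literature.NumberTheory.GaloisRepresentations
open Literature.NumberTheory.EllipticCurves.Kato2004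
open Literature.NumberTheory.EllipticCurves.Kato2004.EulerSystemValues

universe u

namespace Literature.NumberTheory.EllipticCurves.Kim2025

/-! ### `Λ`-algebra: powers of `p` are invisible at the height-one primes `𝔭 ∌ p` -/

section Algebra

variable (p : ℕ) [Fact p.Prime]

/-- `ι(C(p^n) · x) = C(p^n) · ι(x)` for `ι : ℤ_p⟦T⟧ ↪ ℚ_p⟦T⟧`, with the exponent read in `ℤ`.
[cite: MazurTateTeitelbaum1986Invent, §I.12] -/
theorem iwasawaToPowerSeries_C_pow_mul (n : ℕ) (x : IwasawaAlgebra p) :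
    iwasawaToPowerSeries p (PowerSeries.C ((p : ℤ_[p]) ^ n) * x) =
      PowerSeries.C ((p : ℚ_[p]) ^ (n : ℤ)) * iwasawaToPowerSeries p x := by
  rw [map_mul, zpow_natCast]
  congr 1
  simp

variable {p}

/-- **Powers of `p` are invisible off `(p)`**: if `ι g = C(p^k) · ι G₁` in `ℚ_p⟦T⟧` for some `k ∈ ℤ`,
then `ℓ_𝔭(Λ/(g)) = ℓ_𝔭(Λ/(G₁))` at every prime `𝔭 ∌ p` of `Λ` (the ideals `(g)`, `(G₁)` agree after
localisation: `p^{|k|}·g ∈ (G₁)` and `p^{|k|}·G₁ ∈ (g)`).  This is the passage between a main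
identity "in `Λ ⊗ ℚ_p`" (Mazur–Tate–Teitelbaum §I.12; the rational shape of the tree's Skinner–Urban /
BCS facts) and an integral one, away from `(p)`. [cite: MazurTateTeitelbaum1986Invent, §I.12]
[cite: Kato2004Asterisque, §17.13 (p. 280)] -/
theorem lengthAt_quotient_span_eq_of_eq_C_zpow_mul {g G₁ : IwasawaAlgebra p} {k : ℤ}
    (h : iwasawaToPowerSeries p g = PowerSeries.C ((p : ℚ_[p]) ^ k) * iwasawaToPowerSeries p G₁)
    (𝔭 : PrimeSpectrum (IwasawaAlgebra p)) (hp𝔭 : PowerSeries.C (p : ℤ_[p]) ∉ 𝔭.asIdeal) :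
    lengthAt (IwasawaAlgebra p) (IwasawaAlgebra p ⧸ Ideal.span {g}) 𝔭 =
      lengthAt (IwasawaAlgebra p) (IwasawaAlgebra p ⧸ Ideal.span {G₁}) 𝔭 := by
  have hp0 : (p : ℚ_[p]) ≠ 0 := by exact_mod_cast (Fact.out : p.Prime).ne_zero
  set N : ℕ := k.natAbs with hN
  set s : IwasawaAlgebra p := PowerSeries.C ((p : ℤ_[p]) ^ N) with hs
  -- `s ∉ 𝔭`
  have hs𝔭 : s ∉ 𝔭.asIdeal := by
    intro hmem
    rw [hs, map_pow] at hmem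
    exact hp𝔭 (𝔭.isPrime.mem_of_pow_mem N hmem)
  have hNk : 0 ≤ (N : ℤ) + k := by omega
  have hNk' : 0 ≤ (N : ℤ) - k := by omega
  -- `s * g = C(p^{N+k}) * G₁`
  have h1 : s * g = PowerSeries.C ((p : ℤ_[p]) ^ ((N : ℤ) + k).toNat) * G₁ := by
    apply iwasawaToPowerSeries_injective p
    rw [hs, iwasawaToPowerSeries_C_pow_mul, iwasawaToPowerSeries_C_pow_mul, h, ← mul_assoc,
      ← map_mul, ← zpow_add₀ hp0, zpow_natCast, ← zpow_natCast (p : ℚ_[p]) ((N : ℤ) + k).toNat,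
      Int.toNat_of_nonneg hNk]
  -- `s * G₁ = C(p^{N-k}) * g`
  have h2 : s * G₁ = PowerSeries.C ((p : ℤ_[p]) ^ ((N : ℤ) - k).toNat) * g := by
    apply iwasawaToPowerSeries_injective p
    have hG : iwasawaToPowerSeries p G₁ =
        PowerSeries.C ((p : ℚ_[p]) ^ (-k)) * iwasawaToPowerSeries p g := by
      rw [h, ← mul_assoc, ← map_mul, ← zpow_add₀ hp0, neg_add_cancel, zpow_zero, map_one, one_mul]
    rw [hs, iwasawaToPowerSeries_C_pow_mul, iwasawaToPowerSeries_C_pow_mul, hG, ← mul_assoc,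
      ← map_mul, ← zpow_add₀ hp0, ← sub_eq_add_neg, zpow_natCast,
      ← zpow_natCast (p : ℚ_[p]) ((N : ℤ) - k).toNat, Int.toNat_of_nonneg hNk']
  refine lengthAt_quotient_eq_of_localized_eq 𝔭 hs𝔭 ?_ ?_
  · -- `s · (G₁) ⊆ (g)`
    intro j hj
    obtain ⟨r, rfl⟩ := Ideal.mem_span_singleton'.mp hj
    rw [mul_left_comm, h2, ← mul_assoc]
    exact Ideal.mul_mem_left _ _ (Ideal.mem_span_singleton_self g)
  · -- `s · (g) ⊆ (G₁)`
    intro i hi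
    obtain ⟨r, rfl⟩ := Ideal.mem_span_singleton'.mp hi
    rw [mul_left_comm, h1, ← mul_assoc]
    exact Ideal.mul_mem_left _ _ (Ideal.mem_span_singleton_self G₁)

/-- `C p ∉ 𝔭 ⟹ 𝔭` has height `≤ 1` is not needed; but a prime power `(C p)^n ∉ 𝔭` for a prime `𝔭 ∌ C p`.
For the finiteness inputs we only use: a FINITE `Λ`-module has length `0` at every height-one `𝔭 ∌ p`
(`Kato2004.lengthAt_eq_zero_of_finite_of_C_not_mem`). [cite: Kato2004Asterisque, §17.13 (17.13.4) (p. 279)] -/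
theorem lengthAt_range_eq_zero_of_finite_of_C_not_mem {H2 H2loc : Type*} [AddCommGroup H2]
    [_root_.Module (IwasawaAlgebra p) H2] [AddCommGroup H2loc] [_root_.Module (IwasawaAlgebra p) H2loc]
    [Finite H2loc] (ε : H2 →ₗ[IwasawaAlgebra p] H2loc) (𝔭 : PrimeSpectrum (IwasawaAlgebra p))
    (hp𝔭 : PowerSeries.C (p : ℤ_[p]) ∉ 𝔭.asIdeal) :
    lengthAt (IwasawaAlgebra p) (LinearMap.range ε) 𝔭 = 0 :=
  haveI : Finite (LinearMap.range ε) := Finite.of_injective _ Subtype.val_injective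
  lengthAt_eq_zero_of_finite_of_C_not_mem (LinearMap.range ε) 𝔭 hp𝔭

end Algebra

/-! ### Over Kato's §17.13 package with a fine quotient, at a height-one prime `𝔭 ∌ p` -/

section Package

variable {p : ℕ} [Fact p.Prime] {W : WeierstrassCurve ℚ} [W.IsElliptic] [W.IsGloballyMinimal]
  [ContinuousSMul ℤ_[p] (W.tateModule p)] {N : ℕ} [NeZero N] {f : CuspForm (Gamma0 N) 2}
  {κ : ZpExtension ℚ p} {γ : absoluteGaloisGroup ℚ}
  {I : IwasawaH1Data W p κ γ} {D : W.SelmerDualData κ γ}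
  {Y : Type u} [AddCommGroup Y] [_root_.Module (IwasawaAlgebra p) Y]

omit [NeZero N] in
/-- `ℓ_𝔭(Y) = ℓ_𝔭(𝐇²)` at every `𝔭 ∌ p` (`Im ε ⊆ 𝐇²_loc` finite, (17.13.4)).
[cite: Kato2004Asterisque, §17.13 (17.13.1), (17.13.4) (p. 279)] -/
theorem lengthAt_fine_eq_lengthAt_H2_offP (K : DivisibilityInputs W p f κ γ I D)
    (π : D.X →ₗ[IwasawaAlgebra p] Y) (hπs : Function.Surjective π) (hπ : Function.Exact K.toX π)
    (𝔭 : PrimeSpectrum (IwasawaAlgebra p)) (hp𝔭 : PowerSeries.C (p : ℤ_[p]) ∉ 𝔭.asIdeal) :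
    lengthAt (IwasawaAlgebra p) Y 𝔭 = lengthAt (IwasawaAlgebra p) K.H2 𝔭 := by
  have h := lengthAt_fine_add_lengthAt_range_eq K π hπs hπ 𝔭
  haveI := K.finite_H2loc
  rwa [lengthAt_range_eq_zero_of_finite_of_C_not_mem K.ε 𝔭 hp𝔭, add_zero] at h

omit [NeZero N] in
/-- **Kato's p. 280 identity at a height-one `𝔭 ∌ p`, fine quotient in place of `𝐇²`:
`ℓ_𝔭(X) + ℓ_𝔭(𝐇¹_Γ/Z) = ℓ_𝔭(Λ/(G₁)) + ℓ_𝔭(Y)`** (`E[p]` irreducible, `ι G₁ = L_p(E,T)`).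
[cite: Kato2004Asterisque, §17.13 (p. 280), Prop. 17.11 (p. 277), Thm. 16.6 (p. 271)] -/
theorem lengthAt_add_lengthAt_quotient_zeta_eq_offP (K : DivisibilityInputs W p f κ γ I D)
    (hirr : W.HasIrreducibleModPGaloisRep p) {G₁ : IwasawaAlgebra p}
    (hG₁ : iwasawaToPowerSeries p G₁ = padicLFunction f (unitRoot W p : ℚ_[p]))
    (π : D.X →ₗ[IwasawaAlgebra p] Y) (hπs : Function.Surjective π) (hπ : Function.Exact K.toX π)
    (𝔭 : PrimeSpectrum (IwasawaAlgebra p)) (h𝔭 : 𝔭.asIdeal.height = 1)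
    (hp𝔭 : PowerSeries.C (p : ℤ_[p]) ∉ 𝔭.asIdeal) :
    lengthAt (IwasawaAlgebra p) D.X 𝔭 + lengthAt (IwasawaAlgebra p) (I.H ⧸ K.Z) 𝔭 =
      lengthAt (IwasawaAlgebra p) (IwasawaAlgebra p ⧸ Ideal.span {G₁}) 𝔭 +
        lengthAt (IwasawaAlgebra p) Y 𝔭 := by
  haveI := K.finite_coker_col
  haveI := K.finite_H2loc
  have h := lengthAt_add_eq_of_skeleton K.loc K.loc_injective K.toX K.δ K.ε K.exact_P K.exact_X
    K.exact_H2 K.col K.col_injective K.Z 𝔭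
    (lengthAt_eq_zero_of_finite_of_C_not_mem (IwasawaAlgebra p ⧸ LinearMap.range K.col) 𝔭 hp𝔭)
    (lengthAt_eq_zero_of_finite_of_C_not_mem K.H2loc 𝔭 hp𝔭)
    (lengthAt_quotient_colLocZ_eq K hirr hG₁ 𝔭 h𝔭)
  rwa [← lengthAt_fine_eq_lengthAt_H2_offP K π hπs hπ 𝔭 hp𝔭] at h

omit [NeZero N] in
/-- **Fine identity ⟺ Mazur identity at a height-one `𝔭 ∌ p`, over the package** ([K25] proof of
Thm. 3.19: "equivalent … via the global Poitou–Tate duality"): with `E[p]` irreducible and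
`ι G₁ = L_p(E,T) ≠ 0`, `ℓ_𝔭(𝐇¹_Γ/Z) = ℓ_𝔭(Y) ↔ ℓ_𝔭(X(E/ℚ_∞)) = ℓ_𝔭(Λ/(G₁))`.  Both cancelled
summands are finite (`Λ/(G₁)` is killed by `G₁ ≠ 0`; `Y` is finitely generated torsion, from the
package). [cite: Kim2025RefinedTNC, proof of Thm. 3.19 (§3.5.3, chunk p0014:L78–L81)]
[cite: Kato2004Asterisque, §17.13 (p. 280)] -/
theorem fine_iff_mazur_offP (K : DivisibilityInputs W p f κ γ I D)
    (hirr : W.HasIrreducibleModPGaloisRep p) {G₁ : IwasawaAlgebra p}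
    (hG₁ : iwasawaToPowerSeries p G₁ = padicLFunction f (unitRoot W p : ℚ_[p]))
    (hL : padicLFunction f (unitRoot W p : ℚ_[p]) ≠ 0)
    (π : D.X →ₗ[IwasawaAlgebra p] Y) (hπs : Function.Surjective π) (hπ : Function.Exact K.toX π)
    (𝔭 : PrimeSpectrum (IwasawaAlgebra p)) (h𝔭 : 𝔭.asIdeal.height = 1)
    (hp𝔭 : PowerSeries.C (p : ℤ_[p]) ∉ 𝔭.asIdeal) :
    lengthAt (IwasawaAlgebra p) (I.H ⧸ K.Z) 𝔭 = lengthAt (IwasawaAlgebra p) Y 𝔭 ↔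
      lengthAt (IwasawaAlgebra p) D.X 𝔭 =
        lengthAt (IwasawaAlgebra p) (IwasawaAlgebra p ⧸ Ideal.span {G₁}) 𝔭 := by
  have h := lengthAt_add_lengthAt_quotient_zeta_eq_offP K hirr hG₁ π hπs hπ 𝔭 h𝔭 hp𝔭
  have hG0 : G₁ ≠ 0 := by
    rintro rfl
    exact hL (by rw [← hG₁, map_zero])
  have hby : Module.IsTorsionBy (IwasawaAlgebra p) (IwasawaAlgebra p ⧸ Ideal.span {G₁}) G₁ :=
    (Module.isTorsionBy_quotient_iff _ G₁).mpr fun y ↦ by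
      rw [smul_eq_mul]
      exact Ideal.mul_mem_right y _ (Ideal.mem_span_singleton_self G₁)
  have hfinG : lengthAt (IwasawaAlgebra p) (IwasawaAlgebra p ⧸ Ideal.span {G₁}) 𝔭 ≠ ⊤ :=
    lengthAt_ne_top_of_isTorsionBy hG0 hby 𝔭 h𝔭.le
  haveI : Module.Finite (IwasawaAlgebra p) Y := moduleFinite_fine_of_package K π hπs hπ
  have hfinY : lengthAt (IwasawaAlgebra p) Y 𝔭 ≠ ⊤ := by
    obtain ⟨s, hs, hs0⟩ :=
      Submodule.annihilator_top_inter_nonZeroDivisors (isTorsion_fine_of_package K π hπs hπ)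
    exact lengthAt_ne_top_of_isTorsionBy (nonZeroDivisors.ne_zero hs0)
      (fun m ↦ Submodule.mem_annihilator.mp hs m Submodule.mem_top) 𝔭 h𝔭.le
  constructor
  · intro hZ
    rw [hZ] at h
    exact (add_left_inj_of_ne_top hfinY).mp h
  · intro hX
    rw [hX] at h
    exact (add_right_inj_of_ne_top hfinG).mp h

omit [NeZero N] in
/-- **The RATIONAL Mazur-form main identity gives the fine identity off `(p)`.**  If `X(E/ℚ_∞)` is
finitely generated torsion with `char_Λ X = (g)` and `ι g = p^k · L_p(E,T)` (`k ∈ ℤ`; the shape of the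
tree's facts bsd.S21 clause 2 and BCS Thm. 1.1.2 (a)), then for the package's zeta submodule `Z` and
fine quotient `Y`: `ℓ_𝔭(𝐇¹_Γ/Z) = ℓ_𝔭(Y)` at every height-one `𝔭 ∌ p`.
[cite: Kim2025RefinedTNC, Thm. 3.19 and its proof (§3.5.3, chunk p0014:L75–L81)]
[cite: Kato2004Asterisque, §17.13 (p. 280)] [cite: MazurTateTeitelbaum1986Invent, §I.12] -/
theorem fine_offP_of_charIdeal_eq_span (K : DivisibilityInputs W p f κ γ I D)
    (hirr : W.HasIrreducibleModPGaloisRep p) {G₁ : IwasawaAlgebra p}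
    (hG₁ : iwasawaToPowerSeries p G₁ = padicLFunction f (unitRoot W p : ℚ_[p]))
    (hL : padicLFunction f (unitRoot W p : ℚ_[p]) ≠ 0)
    (π : D.X →ₗ[IwasawaAlgebra p] Y) (hπs : Function.Surjective π) (hπ : Function.Exact K.toX π)
    [Module.Finite (IwasawaAlgebra p) D.X] (hX : D.IsTorsion) {g : IwasawaAlgebra p} {k : ℤ}
    (hchar : D.charIdeal = Ideal.span {g})
    (hιg : iwasawaToPowerSeries p g =
      PowerSeries.C ((p : ℚ_[p]) ^ k) * padicLFunction f (unitRoot W p : ℚ_[p]))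
    (𝔭 : PrimeSpectrum (IwasawaAlgebra p)) (h𝔭 : 𝔭.asIdeal.height = 1)
    (hp𝔭 : PowerSeries.C (p : ℤ_[p]) ∉ 𝔭.asIdeal) :
    lengthAt (IwasawaAlgebra p) (I.H ⧸ K.Z) 𝔭 = lengthAt (IwasawaAlgebra p) Y 𝔭 := by
  refine (fine_iff_mazur_offP K hirr hG₁ hL π hπs hπ 𝔭 h𝔭 hp𝔭).mpr ?_
  -- `ℓ_𝔭(X) = ℓ_𝔭(Λ/(g))`: the characteristic ideal determines the height-one lengths
  have hg0 : g ≠ 0 := by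
    rintro rfl
    have h0 : iwasawaToPowerSeries p (0 : IwasawaAlgebra p) = 0 := map_zero _
    rw [h0] at hιg
    have hp0 : (p : ℚ_[p]) ≠ 0 := by exact_mod_cast (Fact.out : p.Prime).ne_zero
    have hu : IsUnit (PowerSeries.C ((p : ℚ_[p]) ^ k)) :=
      IsUnit.map PowerSeries.C (IsUnit.mk0 _ (zpow_ne_zero k hp0))
    exact hL ((hu.mul_right_eq_zero).mp hιg.symm)
  have hby : Module.IsTorsionBy (IwasawaAlgebra p) (IwasawaAlgebra p ⧸ Ideal.span {g}) g :=
    (Module.isTorsionBy_quotient_iff _ g).mpr fun y ↦ by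
      rw [smul_eq_mul]
      exact Ideal.mul_mem_right y _ (Ideal.mem_span_singleton_self g)
  have hQ : Module.IsTorsion (IwasawaAlgebra p) (IwasawaAlgebra p ⧸ Ideal.span {g}) :=
    fun x ↦ ⟨⟨g, mem_nonZeroDivisors_of_ne_zero hg0⟩, @hby x⟩
  have hcharQ : charIdeal (IwasawaAlgebra p) (IwasawaAlgebra p ⧸ Ideal.span {g}) =
      Ideal.span {g} := charIdeal_eq_span_of_lengthAt_eq_quotient hg0 fun _ _ ↦ rfl
  have h1 : lengthAt (IwasawaAlgebra p) D.X 𝔭 =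
      lengthAt (IwasawaAlgebra p) (IwasawaAlgebra p ⧸ Ideal.span {g}) 𝔭 :=
    SkinnerUrban2014.lengthAt_eq_of_charIdeal_eq hX hQ (hchar.trans hcharQ.symm) 𝔭 h𝔭
  rw [h1]
  -- `ℓ_𝔭(Λ/(g)) = ℓ_𝔭(Λ/(G₁))`: powers of `p` are invisible off `(p)`
  exact lengthAt_quotient_span_eq_of_eq_C_zpow_mul (by rw [hιg, hG₁]) 𝔭 hp𝔭

/-- **[K25] Thm. 3.19, (Wan)-slot, for an elliptic curve — via Burungale–Castella–Skinner 2025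
Thm. 1.1.2 (a) (refereed tree fact `burungale_castella_skinner_charIdeal_eq_padicLFunction`): at a
good ordinary `p ≥ 5` with `E[p]` irreducible, the FINE main identity holds at every height-one prime
`𝔭 ∌ p`** ("for every height one prime `𝔓` except `πΛ`" — exactly the printed exception), for the
cyclotomic `(κ, γ)` in the cyclotomic variable, the newform `f` of `W`, every §17.13 package `K`
with fine quotient `π : X ↠ Y`. [cite: Kim2025RefinedTNC, Thm. 3.19 (Wan) (§3.5.3, chunk p0014:L78–L79)]
[cite: BurungaleCastellaSkinner2025, Thm. 1.1.2 (a) (p. 2 of arXiv:2405.00270v2)]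
[cite: Kato2004Asterisque, §17.13 (p. 280)] -/
theorem fine_offP_of_bcs (hBCS : burungale_castella_skinner_charIdeal_eq_padicLFunction)
    (hp : 5 ≤ p) (hord : IsOrdinaryAt W p) (hirr : W.HasIrreducibleModPGaloisRep p)
    (hκ : κ.IsCyclotomic) (hγ : κ.IsTopGenerator γ) (hγ' : IsCyclotomicVariable p γ)
    (hf : IsNewformOf W f) (K : DivisibilityInputs W p f κ γ I D)
    (π : D.X →ₗ[IwasawaAlgebra p] Y) (hπs : Function.Surjective π) (hπ : Function.Exact K.toX π)
    (𝔭 : PrimeSpectrum (IwasawaAlgebra p)) (h𝔭 : 𝔭.asIdeal.height = 1)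
    (hp𝔭 : PowerSeries.C (p : ℤ_[p]) ∉ 𝔭.asIdeal) :
    lengthAt (IwasawaAlgebra p) (I.H ⧸ K.Z) 𝔭 = lengthAt (IwasawaAlgebra p) Y 𝔭 := by
  obtain ⟨hX, g, k, hchar, hιg⟩ :=
    hBCS W p κ γ f hp ((isOrdinaryAt_iff W p).1 hord).1 ((isOrdinaryAt_iff W p).1 hord).2 hirr hκ
      hγ hγ' hf D
  haveI : Module.Finite (IwasawaAlgebra p) D.X :=
    (WeierstrassCurve.SelmerDualData.module_finite_of_isCyclotomic (W := W) (κ := κ) hκ D) hγ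
  obtain ⟨G₁, hG₁⟩ := exists_iwasawaToPowerSeries_eq_padicLFunction
    (by rintro rfl; norm_num at hp) hord hf hirr
  exact fine_offP_of_charIdeal_eq_span K hirr hG₁ (padicLFunction_unitRoot_ne_zero hord hf) π hπs hπ
    hX hchar hιg 𝔭 h𝔭 hp𝔭

/-- **[K25] Thm. 3.19 (SU) for an elliptic curve — via Skinner–Urban 2014 Thm. 3.6.9 (refereed tree
fact bsd.S21 `skinner_urban_main_conjecture`, every odd `p`): at a good ordinary `p ≥ 3` with `E[p]`
irreducible and some multiplicative `ℓ ≠ p` with `p ∤ ord_ℓ(Δ_E)`, the FINE main identity holds at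
every height-one `𝔭 ∌ p`** (print: every `𝔓`; the prime `(p)` — S–U clause 3 under tower
surjectivity — is not derived in this file: WEAKER than print).
[cite: Kim2025RefinedTNC, Thm. 3.19 (SU) (§3.5.3, chunk p0014:L75–L77)]
[cite: SkinnerUrban2014, Thm. 3.6.9 (p. 45)] [cite: Kato2004Asterisque, §17.13 (p. 280)] -/
theorem fine_offP_of_skinnerUrban
    (hSU : skinner_urban_main_conjecture W p (κ := κ) (γ := γ) (f := f))
    (hp : 3 ≤ p) (hord : IsOrdinaryAt W p) (hirr : W.HasIrreducibleModPGaloisRep p)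
    (haux : ∃ ℓ : ℕ, ∃ _ : Fact ℓ.Prime, ℓ ≠ p ∧ W.HasMultiplicativeReductionAtPrime ℓ ∧
      ¬ p ∣ padicValInt ℓ W.minimalDiscriminantInt)
    (hκ : κ.IsCyclotomic) (hγ : κ.IsTopGenerator γ) (hγ' : IsCyclotomicVariable p γ)
    (hf : IsNewformOf W f) (K : DivisibilityInputs W p f κ γ I D)
    (π : D.X →ₗ[IwasawaAlgebra p] Y) (hπs : Function.Surjective π) (hπ : Function.Exact K.toX π)
    (𝔭 : PrimeSpectrum (IwasawaAlgebra p)) (h𝔭 : 𝔭.asIdeal.height = 1)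
    (hp𝔭 : PowerSeries.C (p : ℤ_[p]) ∉ 𝔭.asIdeal) :
    lengthAt (IwasawaAlgebra p) (I.H ⧸ K.Z) 𝔭 = lengthAt (IwasawaAlgebra p) Y 𝔭 := by
  obtain ⟨hX, ⟨g, k, hchar, hιg⟩, -⟩ :=
    hSU hp ((isOrdinaryAt_iff W p).1 hord).1 ((isOrdinaryAt_iff W p).1 hord).2 hirr haux hκ hγ hγ'
      hf D
  haveI : Module.Finite (IwasawaAlgebra p) D.X :=
    (WeierstrassCurve.SelmerDualData.module_finite_of_isCyclotomic (W := W) (κ := κ) hκ D) hγ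
  obtain ⟨G₁, hG₁⟩ := exists_iwasawaToPowerSeries_eq_padicLFunction
    (by rintro rfl; norm_num at hp) hord hf hirr
  exact fine_offP_of_charIdeal_eq_span K hirr hG₁ (padicLFunction_unitRoot_ne_zero hord hf) π hπs hπ
    hX hchar hιg 𝔭 h𝔭 hp𝔭

end Package

/-! ### The instance on the pinned fine Selmer dual -/

section FineSelmerDual

variable {p : ℕ} [Fact p.Prime] {W : WeierstrassCurve ℚ} [W.IsElliptic] [W.IsGloballyMinimal]
  [ContinuousSMul ℤ_[p] (W.tateModule p)] {N : ℕ} [NeZero N] {f : CuspForm (Gamma0 N) 2}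
  {κ : ZpExtension ℚ p} {γ : absoluteGaloisGroup ℚ}

/-- **[K25] Thm. 3.19 for `E/ℚ` at a good ordinary `p ≥ 5` with `E[p]` irreducible, in the FINE
currency on the pinned objects `𝐇¹_Γ(T_pW)` (`Kato2004.IwasawaH1Data`) and `X₀(E/ℚ_∞)`
(`WeierstrassCurve.FineSelmerDualData`), MODULO the two named facts
`burungale_castella_skinner_charIdeal_eq_padicLFunction` (BCS 2025 Thm. 1.1.2 (a), refereed) and
`Kato2004.exists_divisibilityInputs_fineQuotient` (Kato's §17.13 package with the fine quotient):**
there are a package `K` and a fine quotient `π : X ↠ X₀`, and for the package's zeta submodule `Z`,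
`ℓ_𝔭(𝐇¹_Γ/Z) = ℓ_𝔭(X₀)` at EVERY height-one prime `𝔭 ∌ p` ("every height one prime except `πΛ`").
[cite: Kim2025RefinedTNC, Thm. 3.19 (Wan) (§3.5.3, chunk p0014:L78–L79)]
[cite: BurungaleCastellaSkinner2025, Thm. 1.1.2 (a)] [cite: Kato2004Asterisque, (14.9.3) (p. 240) and §17.13 (pp. 279–280)] -/
theorem exists_fine_offP_of_bcs_of_fineQuotient
    (hBCS : burungale_castella_skinner_charIdeal_eq_padicLFunction)
    (hfine : exists_divisibilityInputs_fineQuotient) (hp : 5 ≤ p) (hord : IsOrdinaryAt W p)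
    (hirr : W.HasIrreducibleModPGaloisRep p) (hκ : κ.IsCyclotomic) (hγ : κ.IsTopGenerator γ)
    (hγ' : IsCyclotomicVariable p γ) (hf : IsNewformOf W f)
    (I : IwasawaH1Data W p κ γ) (D : W.SelmerDualData κ γ) (Y : W.FineSelmerDualData κ γ) :
    ∃ (K : DivisibilityInputs W p f κ γ I D) (π : D.X →ₗ[IwasawaAlgebra p] Y.X),
      Function.Surjective π ∧ Function.Exact K.toX π ∧
      ∀ 𝔭 : PrimeSpectrum (IwasawaAlgebra p), 𝔭.asIdeal.height = 1 →
        PowerSeries.C (p : ℤ_[p]) ∉ 𝔭.asIdeal →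
          lengthAt (IwasawaAlgebra p) (I.H ⧸ K.Z) 𝔭 = lengthAt (IwasawaAlgebra p) Y.X 𝔭 := by
  have hp2 : p ≠ 2 := by rintro rfl; norm_num at hp
  obtain ⟨K, π, hπs, hπ⟩ := hfine W p f κ γ hp2 hord hκ hγ hγ' hf I D Y
  exact ⟨K, π, hπs, hπ, fun 𝔭 h𝔭 hp𝔭 ↦
    fine_offP_of_bcs hBCS hp hord hirr hκ hγ hγ' hf K π hπs hπ 𝔭 h𝔭 hp𝔭⟩

end FineSelmerDual

end Literature.NumberTheory.EllipticCurves.Kim2025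

end
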